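import Summits.BirchSwinnertonDyer.BirchSwinnertonDyer.Theorems.KimAtThreeDeepLowerOffStratumLevelLoweringVatsalStabRows
import HarnessLib

/-!
# Route `KimAtThreeKolyvagin` (rung W2), crux `DeepLowerAtThreeOffKatoStratum` (item 19679), registered
# stub `stub_nonAdditive`, ROAD (b): the COVERED rows (ordinary if good, (ram) if multiplicative at `3`) with
# `v₃(∏ c_ℓ) ≤ 1` from a level-`N/q` newform congruent to `D₀.f` — companion of `…VatsalStabRows`

Cell `bsd-addord`, seat `bsd-addord-w2-acc2` (PROGRAMME PART 1b, ACCEL-LIST row (2)), gen 4; item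
`stmt-BirchSwinnertonDyer-19679` (OWNER w2-c2 assembles; `--supports`, closes nothing). `…VatsalStabRows` proved
(LL_1) over `𝓀` on any non-additive tower row from Vatsal 1999 / Greenberg–Vatsal 2000 BY NAME and a level-`M`
newform `g` (`M·q = N_E`, `q ∤ M` SPLIT multiplicative) congruent to `D₀.f`
(`isStabilisedLevelLoweringCongruenceIn_three_of_levelLoweredNewform`), and derived the SEMISTABLE 19679 rows.
This file records the same derivation for the COVERED rows of the registered stub (row C1 ∪ C16 of the cell's
dictionary: good-ORDINARY `3` — Yan–Zhu 2026 Thm. 4.15 —, or multiplicative `3` with (ram) — Skinner 2016 Thm. C),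
whose other bad primes are unrestricted (the Tamagawa-`3` prime `q` itself split multiplicative), through gen 2's
consumer `KimAtThreeDeepLowerOffStratumLevelLoweringRekey.stub_nonAdditive_covered_of_isStabilisedLevelLoweringCongruenceIn`.
Binders: eight named facts (`hV hGV hYZ hW20 hSk hmod hGZK hM`), the registered stub's binders VERBATIM (level
`M·q`), «ordinary if good, (ram) if multiplicative», `v₃(∏ c_ℓ) ≤ 1`, `q` split multiplicative, and the road-(b)
residual {newform `g` of level `M` with its prime congruences, root `β ≡ q`, Condition 1 ×2, non-degeneracy `Ω`}
exactly as in the semistable ★. Theorems only; nothing booked; BSD is not proved by any of this.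

## References

* V. Vatsal, Duke Math. J. 98 (1999), §1 (1.6), Thm. (1.13) [Vatsal1999]; R. Greenberg, V. Vatsal, Invent. Math.
  142 (2000), §3 (17)–(19) [GreenbergVatsal2000]; K. A. Ribet, Invent. Math. 100 (1990), Thm. 1.1 [Ribet1990].
* X. Yan, X. Zhu (2024/2026), Thm. 4.15 [YanZhu2024MainConjNonCM]; C. Skinner, Pacific J. Math. 283 (2016), Thm. C
  [Skinner2016PacificMC]; B. Mazur, Invent. Math. 44 (1978), Cor. 4.1 [Mazur1978]; C.-H. Kim (2022/2026),
  Conj. 1.10 [Kim2022StructureSelmer].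
-/

set_option autoImplicit false
-- the Theorems namespace of a single-conjunct summit repeats the summit name by design (D-0017)
set_option linter.dupNamespace false

noncomputable section

open scoped MatrixGroups ModularForm Classical NNReal

open CongruenceSubgroup WeierstrassCurve Literature.NumberTheory.EllipticCurves
  Literature.NumberTheory.EllipticCurves.ModularForms

namespace Summit.BirchSwinnertonDyer.BirchSwinnertonDyer.Theorems.KimAtThreeDeepLowerOffStratumLevelLoweringVatsalStabCovered

open Summit.BirchSwinnertonDyer.BirchSwinnertonDyer.Theorems.KimAtThreeDeepLowerOffStratumLevelLoweringVatsalStabRows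
open Summit.BirchSwinnertonDyer.BirchSwinnertonDyer.Theorems.KimAtThreeDeepLowerOffStratumLevelLoweringRekey
open Literature.NumberTheory.EllipticCurves.Rank1Residual Literature.NumberTheory.EllipticCurves.Rank1Residual.Typed
  Literature.NumberTheory.EllipticCurves.Skinner2016 Literature.NumberTheory.Automorphic

/-- ★ **`stub_nonAdditive` on its COVERED rows with `v₃(∏ c_ℓ) ≤ 1`, from VATSAL / GREENBERG–VATSAL BY NAME and a
LEVEL-`N/q` NEWFORM congruent to `D₀.f`** (the Tamagawa-`3` prime `q` split multiplicative, the other bad primes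
free). Binders: eight named facts; the registered stub's binders VERBATIM with the level `M·q`; «ordinary if good,
(ram) if multiplicative», `v₃(∏ c_ℓ) ≤ 1`, `q` split multiplicative; the road-(b) residual as in
`…VatsalStabRows.stub_nonAdditive_semistable_of_vatsal_of_levelLoweredNewform`.
[cite: Vatsal1999, §1 (1.6), Thm. (1.13)] [cite: GreenbergVatsal2000, §3 (17)–(19)] [cite: Ribet1990, Thm. 1.1]
[cite: YanZhu2024MainConjNonCM, Thm. 4.15 (§4.6)] [cite: Skinner2016PacificMC, Thm. C (§1)] [cite: Mazur1978, Cor. 4.1]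
[cite: Kim2022StructureSelmer, Conj. 1.10 (PDF p. 8)] -/
theorem stub_nonAdditive_covered_of_vatsal_of_levelLoweredNewform
    (hV : vatsal1999_plusSymbol_congruence) (hGV : greenbergVatsal2000_plusSymbol_congruence)
    (hYZ : YanZhu2026.thm415_padicValRat_bsd_rank_le_one)
    (hW20 : Wuthrich2014.lemma20_surjective_threeAdic_of_semistable)
    (hSk : Skinner2016.thmC_padicValRat_bsd_rank_zero)
    (hmod : hasEntireLFunction_rat) (hGZK : rank_eq_analyticRank_of_analyticRank_le_one)
    (hM : mazur_not_dvd_maninConstant_of_odd) :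
    ∀ (W₀ : WeierstrassCurve ℚ) [W₀.IsElliptic] [W₀.IsGloballyMinimal],
      (∀ n : ℕ, W₀.HasSurjectiveModNGaloisRep (3 ^ n : ℕ)) → Finite W₀.sha →
      ∀ {M q : ℕ} [NeZero M] [NeZero q] [Fact q.Prime] [NeZero (M * q)], M * q = W₀.conductorNorm ℤ →
      ∀ (D₀ : ModularParametrizationData W₀ (M * q)),
        (∀ z ∈ D₀.L.lattice, ∃ w ∈ periodLattice D₀.f, z = D₀.c * w) →
        (∀ (W₂ : WeierstrassCurve ℚ) [W₂.IsElliptic] (D₂ : ModularParametrizationData W₂ (M * q)),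
          D₂.f = D₀.f → D₀.modularDegree ≤ D₂.modularDegree) →
        (∀ r : ℚ, ratPlusSymbol D₀.f r ≠ 0 → 0 ≤ padicValRat 3 (ratPlusSymbol D₀.f r)) →
        kuriharaVanishingOrder W₀ 3 D₀.f = 0 →
        ¬ (haveI : Fact (Nat.Prime 3) := ⟨Nat.prime_three⟩; Addv W₀ 3) →
        (W₀.HasGoodReductionAtPrime 3 → ¬ (3 : ℤ) ∣ W₀.frobeniusTrace 3) →
        (W₀.HasMultiplicativeReductionAtPrime 3 →
          (haveI : Fact (Nat.Prime 3) := ⟨Nat.prime_three⟩; Ram W₀ 3)) →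
        padicValNat 3 W₀.tamagawaProduct ≤ 1 →
        W₀.HasSplitMultiplicativeReductionAtPrime q →
        ∀ (ι : PadicAlgCl 3 ≃+* ℂ) (g : CuspForm (Gamma0 M) 2), IsNewform0 g → ¬ q ∣ M →
          (∀ ℓ : ℕ, ℓ.Prime → ℓ ≠ q → Valued.v (ι.symm (cuspCoeff D₀.f ℓ - cuspCoeff g ℓ)) < 1) →
          Valued.v (ι.symm (cuspCoeff g q - (q + 1))) < 1 →
        ∀ (β : ℂ), β ^ 2 - cuspCoeff g q * β + q = 0 → Valued.v (ι.symm (β - q)) < 1 →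
          HasSimpleHeckeGenEigenspace D₀.f →
          HasSimpleHeckeGenEigenspace
            (iota M (M * q) 1 2 (mul_dvd_mul_left M (one_dvd q)) g - β • iota M (M * q) q 2 dvd_rfl g) →
        ∀ (Ω : ℂ), (∀ x : ℚ, Valued.v (ι.symm (plusSymbol g x / Ω)) ≤ 1) →
          (∃ x₀ : ℚ, Valued.v (ι.symm ((plusSymbol g x₀ - β / q * plusSymbol g (q * x₀)) / Ω)) = 1) →
        ∃ d : ℕ, kuriharaPartialDeepInfty W₀ 3 D₀.f = d ∧
          kuriharaPartial W₀ 3 D₀.f 0 ≤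
            ((padicValNat 3 (Nat.card (AddCommGroup.primaryComponent W₀.sha 3)) + d : ℕ) : ℕ∞) := by
  intro W₀ _ _ htower hfin M q _ _ _ _ hN D₀ hopt hdeg hint hord hnA hordinary hram hv hsplit ι g hg hqM hcℓ haq β hβ
    hβq hfC hgC Ω hΩint hΩunit
  obtain ⟨π, hLL⟩ := isStabilisedLevelLoweringCongruenceIn_three_of_levelLoweredNewform hV hGV W₀ htower Fact.out hN D₀
    hint hnA hsplit ι hg hqM hcℓ haq hβ hβq hfC hgC hΩint hΩunit
  exact stub_nonAdditive_covered_of_isStabilisedLevelLoweringCongruenceIn hYZ hW20 hSk hmod hGZK hM W₀ htower hfin hN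
    D₀ hopt hdeg hint hord hnA hordinary hram hv π q (hN ▸ dvd_mul_left q M) hLL

end Summit.BirchSwinnertonDyer.BirchSwinnertonDyer.Theorems.KimAtThreeDeepLowerOffStratumLevelLoweringVatsalStabCovered

end
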